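import Summits.ResolutionOfSingularities.ResolutionOfSingularities.Theorems.WeightedInvariantHypersurfacePairStepFunctional
import Summits.ResolutionOfSingularities.ResolutionOfSingularities.Theorems.WeightedInvariantTerminatingCentreDatumRank
import Summits.ResolutionOfSingularities.ResolutionOfSingularities.Theorems.WeightedInvariantWeightedThesisHypersurfaceChoice
import HarnessLib

/-!
# A hypersurface centre CHOICE with centres in the singular locus IS a hypersurface terminating centre datum (door H1)

Route `ResolutionOfSingularities/WeightedInvariant`, crux `Theses.WeightedInvariant.HypersurfaceCentreConstruction`
(stmt-ResolutionOfSingularities-19897), door line `local-engine`, CRUX-PLAN r1 of `res-L1-w43-plan-1`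
(sketch `L/res-L1-w43-plan-1/door_globalize_sketch.lean`, sha16 `4548141fdf78465f`): helper **H1
`(G-rank)` — PACKAGING**.  A `HypersurfaceCentreChoice p` (`Theorems/…HypersurfaceChoice.lean`: total
centre rule with `(iii)` regular weighted centre, `(ii′)` generic point off the support, `(H)` homogeneity on
torus charts, `(T)` well-founded tower step `HypersurfacePair.Step centre` over every perfect field of
characteristic `p`) whose centres lie under the non-regular locus of the hypersurface (`(iii-b′)`, the
hypothesis `hsupp`) IS a `HypersurfaceTerminatingCentreDatum p` (`Theorems/…TerminatingCentreDatum.lean`),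
with

* `Γ := Bool`, `inv := CentreRankDatum.singRating` (the rating detecting the non-regular locus; its `(ii)`
  is `CentreRankDatum.isBot_singRating_iff`);
* `Λ := ℕ`, `rank f X := HypersurfaceCentreChoice.stepRank C f X` = (height of the pair `(Y, f, X)` in the
  tower of `C.centre`, `HypersurfacePair.stepHeight`) `+ 1` when `(f, X)` is a hypersurface pair over a
  perfect field of characteristic `p`, and `0` otherwise;
* `(term)`: along a Rees filtration `R'` with the pieces of the centre, the successor
  `(R'.πPlus ≫ f, R'.strictTransformPlus X)` is either again a hypersurface pair — then it is THE
  `Step`-successor (`HypersurfacePair.Step.intro`; the step is functional, H1a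
  `HypersurfacePair.step_subsingleton`) and the height drops by one — or it is not, and its rank is `0`.

Main declarations: `HypersurfacePair.stepHeight` (+ `stepHeight_eq_succ_of_step`,
`stepHeight_lt_of_step`), `singImage`, `HypersurfaceCentreChoice.stepRank` (+ `stepRank_eq`,
`stepRank_lt`), `HypersurfaceCentreChoice.toHypersurfaceTerminating`, and the sketch's target
`nonempty_hypersurfaceTerminatingCentreDatum_of_choice` (signature verbatim up to the namespace of
`singImage`).  The content of the door (H2 `(G-glob)`: the local engine yields such a choice) is NOT
touched.  Nothing here is a claim about Hironaka's problem; no `Nonempty` of anything is asserted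
unconditionally.
-/

noncomputable section

open CategoryTheory AlgebraicGeometry TopologicalSpace
open Literature.AlgebraicGeometry.Resolution

set_option linter.dupNamespace false -- mandated namespace of this single-conjunct summit

namespace Summit.ResolutionOfSingularities.ResolutionOfSingularities.Theorems

/-! ## The height of a pair along a well-founded (functional) tower step -/

namespace HypersurfacePair

variable {k : Type} [Field k]

open scoped Classical in
/-- **Height of a hypersurface pair in the tower of the centre rule `c`** (for `Step c` well-founded):
`0` if `P` has no `Step c`-successor, else the height of its (unique, `step_subsingleton`) successor
plus one — the number of tower steps issued from `P`.  Defined by well-founded recursion on `Step c`.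
[folklore] -/
def stepHeight
    (c : ∀ ⦃Y : Scheme.{0}⦄, (Y ⟶ Spec (.of k)) → Y.IdealSheafData → ReesAlgebraData Y)
    (hwf : WellFounded (Step c)) : HypersurfacePair k → ℕ :=
  hwf.fix fun P IH =>
    if h : ∃ P', Step c P' P then IH (Classical.choose h) (Classical.choose_spec h) + 1 else 0

open scoped Classical in
/-- Unfolding equation of `stepHeight`. [folklore] -/
theorem stepHeight_eq
    (c : ∀ ⦃Y : Scheme.{0}⦄, (Y ⟶ Spec (.of k)) → Y.IdealSheafData → ReesAlgebraData Y)
    (hwf : WellFounded (Step c)) (P : HypersurfacePair k) :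
    stepHeight c hwf P =
      if h : ∃ P', Step c P' P then stepHeight c hwf (Classical.choose h) + 1 else 0 := by
  unfold stepHeight
  rw [WellFounded.fix_eq]

/-- A pair without successor has height `0`. [folklore] -/
theorem stepHeight_eq_zero
    (c : ∀ ⦃Y : Scheme.{0}⦄, (Y ⟶ Spec (.of k)) → Y.IdealSheafData → ReesAlgebraData Y)
    (hwf : WellFounded (Step c)) {P : HypersurfacePair k} (h : ∀ P', ¬ Step c P' P) :
    stepHeight c hwf P = 0 := by
  rw [stepHeight_eq, dif_neg (not_exists.mpr h)]

/-- **The height drops by exactly one at the successor** (functionality of the step,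
`step_subsingleton`). [folklore] -/
theorem stepHeight_eq_succ_of_step
    (c : ∀ ⦃Y : Scheme.{0}⦄, (Y ⟶ Spec (.of k)) → Y.IdealSheafData → ReesAlgebraData Y)
    (hwf : WellFounded (Step c)) {P P' : HypersurfacePair k} (h : Step c P' P) :
    stepHeight c hwf P = stepHeight c hwf P' + 1 := by
  have hex : ∃ P'', Step c P'' P := ⟨P', h⟩
  rw [stepHeight_eq, dif_pos hex, step_subsingleton c P _ P' (Classical.choose_spec hex) h]

/-- The height of the successor is smaller. [folklore] -/
theorem stepHeight_lt_of_step
    (c : ∀ ⦃Y : Scheme.{0}⦄, (Y ⟶ Spec (.of k)) → Y.IdealSheafData → ReesAlgebraData Y)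
    (hwf : WellFounded (Step c)) {P P' : HypersurfacePair k} (h : Step c P' P) :
    stepHeight c hwf P' < stepHeight c hwf P := by
  rw [stepHeight_eq_succ_of_step c hwf h]
  exact Nat.lt_succ_self _

end HypersurfacePair

/-! ## The image of the non-regular locus -/

/-- **The image in `Y` of the non-regular locus of `V(X)`** — the set `(iii-b′)` of a terminating
centre datum confines centres to (spelled out in `CentreRankDatum.support_centre_subset`); `y` lies in it
iff `CentreRankDatum.singRating X y` is not minimal.  Verbatim the sketch's `singImage`. [folklore] -/
def singImage {Y : Scheme.{0}} (X : Y.IdealSheafData) : Set Y :=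
  {y : Y | ∃ x : X.subscheme, X.subschemeι x = y ∧ ¬ IsRegularLocalRing (X.subscheme.presheaf.stalk x)}

/-- Membership in `singImage X` is non-minimality of the `Bool` rating `singRating X`. [folklore] -/
theorem mem_singImage_iff_not_isBot_singRating {Y : Scheme.{0}} (X : Y.IdealSheafData) (y : Y) :
    y ∈ singImage X ↔ ¬ IsBot (CentreRankDatum.singRating X y) := by
  rw [CentreRankDatum.isBot_singRating_iff]
  simp only [singImage, Set.mem_setOf_eq]
  push Not
  rfl

/-! ## The rank of a hypersurface centre choice -/

namespace HypersurfaceCentreChoice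

variable {p : ℕ} (C : HypersurfaceCentreChoice p)

/-- The centre rule of `C` over the field `k`, in the shape `HypersurfacePair.Step` consumes. [folklore] -/
abbrev centreRule (k : Type) [Field k] :
    ∀ ⦃Y : Scheme.{0}⦄, (Y ⟶ Spec (.of k)) → Y.IdealSheafData → ReesAlgebraData Y :=
  fun ⦃_⦄ f X => C.centre f X

/-- `(T)` of the choice, for `centreRule`. [folklore] -/
theorem wellFounded_step_centreRule (k : Type) [Field k] [CharP k p] [PerfectField k] :
    WellFounded (HypersurfacePair.Step (C.centreRule k)) :=
  C.wellFounded_step (k := k)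

/-- **The termination rank of a pair for the choice `C`** (total in the pair, `ℕ`-valued): if `k` is a
perfect field of characteristic `p` and `(f : Y → Spec k, X)` is a hypersurface pair (smooth separated
quasi-compact ambient, `X` locally principal with integral `V(X)`), the height of that pair in the tower
of `C.centre` plus one; otherwise `0`. [folklore] -/
def stepRank ⦃k : Type⦄ [Field k] ⦃Y : Scheme.{0}⦄ (f : Y ⟶ Spec (.of k)) (X : Y.IdealSheafData) : ℕ :=
  haveI := Classical.propDecidable
  if h : (CharP k p ∧ PerfectField k) ∧ (Smooth f ∧ IsSeparated f ∧ QuasiCompact f) ∧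
      IsLocallyPrincipal X ∧ IsIntegral X.subscheme then
    HypersurfacePair.stepHeight (C.centreRule k)
      (by haveI := h.1.1; haveI := h.1.2; exact C.wellFounded_step_centreRule k)
      (@HypersurfacePair.mk k _ Y f h.2.1.1 h.2.1.2.1 h.2.1.2.2 X h.2.2.1 h.2.2.2) + 1
  else 0

/-- On a hypersurface pair over a perfect field of characteristic `p` the rank is the height plus one.
[folklore] -/
theorem stepRank_eq {k : Type} [Field k] [CharP k p] [PerfectField k] {Y : Scheme.{0}}
    (f : Y ⟶ Spec (.of k)) [Smooth f] [IsSeparated f] [QuasiCompact f] (X : Y.IdealSheafData)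
    (hX : IsLocallyPrincipal X) (hXi : IsIntegral X.subscheme) :
    C.stepRank f X =
      HypersurfacePair.stepHeight (C.centreRule k) (C.wellFounded_step_centreRule k)
        (@HypersurfacePair.mk k _ Y f ‹_› ‹_› ‹_› X hX hXi) + 1 := by
  have h : (CharP k p ∧ PerfectField k) ∧ (Smooth f ∧ IsSeparated f ∧ QuasiCompact f) ∧
      IsLocallyPrincipal X ∧ IsIntegral X.subscheme := ⟨⟨‹_›, ‹_›⟩, ⟨‹_›, ‹_›, ‹_›⟩, hX, hXi⟩
  simp only [stepRank, dif_pos h]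

/-- Off the hypersurface pairs over perfect fields of characteristic `p` the rank is `0`. [folklore] -/
theorem stepRank_eq_zero {k : Type} [Field k] {Y : Scheme.{0}} (f : Y ⟶ Spec (.of k))
    (X : Y.IdealSheafData)
    (h : ¬ ((CharP k p ∧ PerfectField k) ∧ (Smooth f ∧ IsSeparated f ∧ QuasiCompact f) ∧
      IsLocallyPrincipal X ∧ IsIntegral X.subscheme)) :
    C.stepRank f X = 0 := by
  simp only [stepRank, dif_neg h]

/-- **`(term)` for the choice: the rank drops along the tower step.**  For a singular hypersurface
pair `(f, X)` over a perfect field of characteristic `p` and a Rees filtration `R'` with the pieces of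
the centre, the successor `(R'.πPlus ≫ f, σˢ(X)|_{B₊})` has smaller rank: if it is again a hypersurface
pair it is the `Step`-successor (`HypersurfacePair.Step.intro`) and the height drops by one
(`HypersurfacePair.stepHeight_lt_of_step`, via H1a); otherwise its rank is `0`. [folklore] -/
theorem stepRank_lt {k : Type} [Field k] [CharP k p] [PerfectField k] {Y : Scheme.{0}}
    (f : Y ⟶ Spec (.of k)) [Smooth f] [IsSeparated f] [QuasiCompact f] (X : Y.IdealSheafData)
    (hX : IsLocallyPrincipal X) (hXi : IsIntegral X.subscheme)
    (hsing : ¬ Scheme.IsRegular X.subscheme)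
    (R' : ReesFiltration Y) (hR' : R'.ideal = (C.centre f X).piece) :
    C.stepRank (R'.πPlus ≫ f) (R'.strictTransformPlus X) < C.stepRank f X := by
  classical
  rw [C.stepRank_eq f X hX hXi]
  by_cases hsucc : (Smooth (R'.πPlus ≫ f) ∧ IsSeparated (R'.πPlus ≫ f) ∧
      QuasiCompact (R'.πPlus ≫ f)) ∧ IsLocallyPrincipal (R'.strictTransformPlus X) ∧
      IsIntegral (R'.strictTransformPlus X).subscheme
  · obtain ⟨⟨hs, hsep, hqc⟩, hlp, hint⟩ := hsucc
    rw [C.stepRank_eq (R'.πPlus ≫ f) (R'.strictTransformPlus X) hlp hint, Nat.add_lt_add_iff_right]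
    refine HypersurfacePair.stepHeight_lt_of_step (C.centreRule k) (C.wellFounded_step_centreRule k) ?_
    exact HypersurfacePair.Step.intro (c := C.centreRule k) (@HypersurfacePair.mk k _ Y f ‹_› ‹_› ‹_› X hX hXi)
      hsing R' hR' hs hsep hqc hlp hint
  · rw [C.stepRank_eq_zero (R'.πPlus ≫ f) (R'.strictTransformPlus X) fun h => hsucc h.2]
    exact Nat.succ_pos _

/-- **H1 `(G-rank)` — a hypersurface centre choice with centres under the non-regular locus is a
hypersurface terminating centre datum** (`Γ := Bool`, `inv := singRating`, `Λ := ℕ`,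
`rank := stepRank`; `(iii-a)`, `(hom)` are the choice's `(iii)`, `(H)`; `(iii-b′)` is the hypothesis
`hsupp`; `(term)` is `stepRank_lt`). [folklore] -/
def toHypersurfaceTerminating
    (hsupp : ∀ ⦃k : Type⦄ [Field k] [CharP k p] [PerfectField k] ⦃Y : Scheme.{0}⦄
      (f : Y ⟶ Spec (.of k)) [Smooth f] [IsSeparated f] [QuasiCompact f] (X : Y.IdealSheafData),
      IsLocallyPrincipal X → IsIntegral X.subscheme → ¬ Scheme.IsRegular X.subscheme →
      (C.centre f X).support ⊆ singImage X) :
    HypersurfaceTerminatingCentreDatum p where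
  Γ := Bool
  inv := fun _ _ _ _ X y => CentreRankDatum.singRating X y
  centre := C.centre
  Λ := ℕ
  rank := fun _ _ _ f X => C.stepRank f X
  isBot_inv_iff := fun _ _ _ _ _ _ _ _ _ X _ _ y => CentreRankDatum.isBot_singRating_iff X y
  isRegularWeightedCentre_centre := fun _ _ _ _ _ f _ _ _ X hX hXi h =>
    C.isRegularWeightedCentre_centre f X hX hXi
      ((CentreRankDatum.exists_not_isBot_singRating_iff X).mp h)
  support_centre_subset := fun _ _ _ _ _ f _ _ _ X hX hXi h y hy =>
    (mem_singImage_iff_not_isBot_singRating X y).mp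
      (hsupp f X hX hXi ((CentreRankDatum.exists_not_isBot_singRating_iff X).mp h) hy)
  centre_isHomogeneous := fun _ _ _ _ _ f _ _ _ X hX hXi h _ W 𝒜 _ h0 hXhom n =>
    C.centre_isHomogeneous f X hX hXi ((CentreRankDatum.exists_not_isBot_singRating_iff X).mp h)
      W 𝒜 h0 hXhom n
  rank_lt := fun _ _ _ _ _ f _ _ _ X hX hXi h R' hR' =>
    C.stepRank_lt f X hX hXi ((CentreRankDatum.exists_not_isBot_singRating_iff X).mp h) R' hR'

/-- The packaged datum keeps the centre. [folklore] -/
@[simp] theorem toHypersurfaceTerminating_centre (hsupp) :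
    (C.toHypersurfaceTerminating hsupp).centre = C.centre := rfl

/-- The packaged datum is rated by `singRating` (`Γ := Bool`). [folklore] -/
theorem toHypersurfaceTerminating_inv (hsupp) {k : Type} [Field k] {Y : Scheme.{0}}
    (f : Y ⟶ Spec (.of k)) (X : Y.IdealSheafData) (y : Y) :
    (C.toHypersurfaceTerminating hsupp).inv f X y = CentreRankDatum.singRating X y := rfl

/-- The packaged datum is ranked by `stepRank` (`Λ := ℕ`). [folklore] -/
theorem toHypersurfaceTerminating_rank (hsupp) {k : Type} [Field k] {Y : Scheme.{0}}
    (f : Y ⟶ Spec (.of k)) (X : Y.IdealSheafData) :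
    (C.toHypersurfaceTerminating hsupp).rank f X = C.stepRank f X := rfl

end HypersurfaceCentreChoice

/-- **H1 `(G-rank)` — PACKAGING (the sketch's target, signature verbatim): a hypersurface centre choice
in characteristic `p` whose centres lie in the image of the non-regular locus yields a hypersurface
terminating centre datum in characteristic `p`.**  Witness: `HypersurfaceCentreChoice.toHypersurfaceTerminating`
(`Γ := Bool`, `Λ := ℕ`, rank = tower height `+ 1`).  Composed with H2 `(G-glob)` (the local engine yields
such a choice — NOT proved here, the honest residual of line `local-engine`) this is the registered door
stub `stub_globalizeLocalDropHypersurface` (sketch `globalizeLocalDropHypersurface_of_pieces`). [folklore] -/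
theorem nonempty_hypersurfaceTerminatingCentreDatum_of_choice (p : ℕ) (C : HypersurfaceCentreChoice p)
    (hsupp : ∀ ⦃k : Type⦄ [Field k] [CharP k p] [PerfectField k] ⦃Y : Scheme.{0}⦄
      (f : Y ⟶ Spec (.of k)) [Smooth f] [IsSeparated f] [QuasiCompact f] (X : Y.IdealSheafData),
      IsLocallyPrincipal X → IsIntegral X.subscheme → ¬ Scheme.IsRegular X.subscheme →
      (C.centre f X).support ⊆ singImage X) :
    Nonempty (HypersurfaceTerminatingCentreDatum p) :=
  ⟨C.toHypersurfaceTerminating hsupp⟩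

end Summit.ResolutionOfSingularities.ResolutionOfSingularities.Theorems

end
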